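import Mathlib
import HarnessLib
import Summits.CriticalPhenomena.PercolationContinuityZ3.Theorems.PercNearOneGluingNoHeavyLowerTailKnQuestion8AntitheticPureBroom

/-!
# `NoHeavyLowerTail` (crux stmt-CriticalPhenomena-4575), antithetic vdBHK programme: the RELATIVE HUB LEMMA for BROOMS (THEOREM Q⁺)

Support file (seat `prim-ineq-gen-7` gen 30; `--supports stmt-CriticalPhenomena-4575`).  Nothing is asserted about the crux; no `sorry`,
no definitions.  Memo: run/shared/lean/prim/prim-ineq-gen-7/FINDING-RHL-g30.md §2–§3.

CONTEXT.  Gen 30's GENERAL HUB IDENTITY writes the localized pure functional `Σ_{ρ∈Z} q_E(ρ)` of the colouring poset of a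
root-degree-1 tree `f + (E₁ ⊔ (g + E″))` as the functional of the contracted forest `E₁ ⊔ E″` on the part `F′` plus, for every level `y`,
a RELATIVE term on a copy of `P = F_{E₁}`: the `P`-functional of the level slice, plus a bonus at the slice tops (extra `α`-routes for
their certificates), minus the certificate losses `c_old − c_new` of the `F′`-tops of that level ('phantoms').  The RELATIVE HUB LEMMA
`RHL(P)` asserts that this relative term is `≥ 0` for all admissible external data; with it, `L-PURE(E₁ ⊔ E″) ⟹ L-PURE(E₁ ⊔ (g+E″))`.
This file proves `RHL` for every BROOM poset `P` (`E₁ = r` leaves, all `r`), in the abstract form of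
`AntitheticPureBroom.broom_lpure` (gen 29, THEOREM Q), which it uses for the phantom-free phases: index type `α` (red-leaf sets), an
involution `bar`, bottom parts `A0,A0',B0,B0'`, top parts `A,A',B,B'` with `X0 ≠ ∅ ⟹ X = univ`, up-closures `UA ⊇ A0,…`, a down-set
(`ZB`, `ZT`) with `ZT ≠ ∅ ⟹ ZB = univ`, and the external data of the `F′`-top above each top `γ`: memberships `SA,SA',SB,SB'`,
`α`-routes `LA ⊆ SA,…` and charges `ZTT`, subject to the realizable constraints (C2) `A0 ≠ ∅ ⟹ SA = univ` (a bottom in `a` lies below every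
`F′`-top), (C3) `ZTT ≠ ∅ ⟹ ZB = univ`, (C5) `LA ≠ ∅ ⟹ A = univ` (an `α`-witness lies below every top).  Conclusion:
`0 ≤ Σ_{γ∈ZB} q_bot(γ) + Σ_{γ∈ZT} q⁺_top(γ) − Σ_{γ∈ZTT} (c_old − c_new)(γ)`.
Proof: a charged phantom with a type-1 loss forces the phase `A = B' = univ, A0' = B0 = ∅, ZB = univ`, in which the inequality is
pointwise in `γ` (finite `decide`s); symmetrically for type 2; otherwise losses are `≤ 0`, the bonus is `≥ 0` and THEOREM Q applies.

* `AntitheticRelBroom.broom_rhl` — THEOREM Q⁺ (RHL for brooms, all `r`). [this work]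
-/

namespace Summit.CriticalPhenomena.PercolationContinuityZ3.Theorems

open Finset

namespace AntitheticRelBroom
set_option synthInstance.maxSize 100000 in
/-- bottoms are nonnegative (`decide`, as in gen 29). -/
private theorem botN : ∀ (a0 a0' b0 b0' xa xa' xb xb' : Bool),
    (a0 = true → xa = true) → (a0' = true → xa' = true) → (b0 = true → xb = true) → (b0' = true → xb' = true) →
    0 ≤ (((if a0 then (1:ℤ) else 0) - (if a0' then (1:ℤ) else 0)) * ((if b0 then (1:ℤ) else 0) - (if b0' then (1:ℤ) else 0))
        + (if ((xa ∧ ¬ a0' ∧ ¬ b0 ∧ xb') ∨ (xa' ∧ ¬ a0 ∧ xb ∧ ¬ b0')) then (1:ℤ) else 0)) := by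
  decide
set_option synthInstance.maxSize 100000 in
/-- phase 1 (`A = B' = univ`, `A0' = B0 = ∅`), bottoms: `q_bot ≥ 1 − [γ ∈ A0 ∩ B0']` (`decide`). -/
private theorem botP1 : ∀ (a0 a0' b0 b0' xa xa' xb xb' : Bool),
    xa = true → xb' = true → a0' = false → b0 = false →
    1 - (if (a0 ∧ b0') then (1:ℤ) else 0) ≤
      (((if a0 then (1:ℤ) else 0) - (if a0' then (1:ℤ) else 0)) * ((if b0 then (1:ℤ) else 0) - (if b0' then (1:ℤ) else 0))
        + (if ((xa ∧ ¬ a0' ∧ ¬ b0 ∧ xb') ∨ (xa' ∧ ¬ a0 ∧ xb ∧ ¬ b0')) then (1:ℤ) else 0)) := by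
  decide
set_option synthInstance.maxSize 100000 in
/-- phase 2 (`A' = B = univ`, `A0 = B0' = ∅`), bottoms: `q_bot ≥ 1 − [γ ∈ A0' ∩ B0]` (`decide`). -/
private theorem botP2 : ∀ (a0 a0' b0 b0' xa xa' xb xb' : Bool),
    xa' = true → xb = true → a0 = false → b0' = false →
    1 - (if (a0' ∧ b0) then (1:ℤ) else 0) ≤
      (((if a0 then (1:ℤ) else 0) - (if a0' then (1:ℤ) else 0)) * ((if b0 then (1:ℤ) else 0) - (if b0' then (1:ℤ) else 0))
        + (if ((xa ∧ ¬ a0' ∧ ¬ b0 ∧ xb') ∨ (xa' ∧ ¬ a0 ∧ xb ∧ ¬ b0')) then (1:ℤ) else 0)) := by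
  decide
set_option synthInstance.maxSize 100000 in
/-- phase 1, tops with bonus: `q⁺_top ≥ −[γ ∉ A' ∪ B, no route]` (`decide`). -/
private theorem topP1 : ∀ (a a' b b' ua ua' ub ub' la la' lb lb' : Bool),
    a = true → b' = true →
    - (if (¬ a' ∧ ¬ b ∧ ¬ ((ua ∨ la) ∧ (ub' ∨ lb'))) then (1:ℤ) else 0) ≤
      (((if a then (1:ℤ) else 0) - (if a' then (1:ℤ) else 0)) * ((if b then (1:ℤ) else 0) - (if b' then (1:ℤ) else 0))
        + (if ((((ua ∨ la) ∧ ¬ a' ∧ ¬ b ∧ (ub' ∨ lb')) ∨ ((ua' ∨ la') ∧ ¬ a ∧ (ub ∨ lb) ∧ ¬ b'))) then (1:ℤ) else 0)) := by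
  decide
set_option synthInstance.maxSize 100000 in
/-- phase 2, tops with bonus (`decide`). -/
private theorem topP2 : ∀ (a a' b b' ua ua' ub ub' la la' lb lb' : Bool),
    a' = true → b = true →
    - (if (¬ a ∧ ¬ b' ∧ ¬ ((ua' ∨ la') ∧ (ub ∨ lb))) then (1:ℤ) else 0) ≤
      (((if a then (1:ℤ) else 0) - (if a' then (1:ℤ) else 0)) * ((if b then (1:ℤ) else 0) - (if b' then (1:ℤ) else 0))
        + (if ((((ua ∨ la) ∧ ¬ a' ∧ ¬ b ∧ (ub' ∨ lb')) ∨ ((ua' ∨ la') ∧ ¬ a ∧ (ub ∨ lb) ∧ ¬ b'))) then (1:ℤ) else 0)) := by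
  decide
set_option synthInstance.maxSize 100000 in
/-- the new certificate with only its type-1 route is at most the new certificate (`decide`). -/
private theorem cnew1_le : ∀ (ua ua' ub ub' sa sa' sb sb' : Bool),
    (if (ua ∧ ¬ sa' ∧ ¬ sb ∧ ub') then (1:ℤ) else 0) ≤
      (if ((ua ∧ ¬ sa' ∧ ¬ sb ∧ ub') ∨ (ua' ∧ ¬ sa ∧ ¬ sb' ∧ ub)) then (1:ℤ) else 0) := by
  decide
set_option synthInstance.maxSize 100000 in
/-- the new certificate with only its type-2 route is at most the new certificate (`decide`). -/
private theorem cnew2_le : ∀ (ua ua' ub ub' sa sa' sb sb' : Bool),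
    (if (ua' ∧ ¬ sa ∧ ¬ sb' ∧ ub) then (1:ℤ) else 0) ≤
      (if ((ua ∧ ¬ sa' ∧ ¬ sb ∧ ub') ∨ (ua' ∧ ¬ sa ∧ ¬ sb' ∧ ub)) then (1:ℤ) else 0) := by
  decide
set_option synthInstance.maxSize 100000 in
/-- mainP1, case `zt = false`, `inzt = false` (`decide`, fourteen Booleans). -/
private theorem mainP1_ff : ∀ (a0 b0' a' b ua ub' sa sa' sb sb' la la' lb lb' : Bool),
    (la = true → sa = true) → (la' = true → sa' = true) → (lb = true → sb = true) → (lb' = true → sb' = true) → (la' = true → a' = true) → (lb = true → b = true) →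
    (a0 = true → ua = true) → (b0' = true → ub' = true) → (a0 = true → sa = true) → (b0' = true → sb' = true) →
    0 ≤ (1 - (if (a0 ∧ b0') then (1:ℤ) else 0))
        - (if false then (if (¬ a' ∧ ¬ b ∧ ¬ ((ua ∨ la) ∧ (ub' ∨ lb'))) then (1:ℤ) else 0) else 0)
        - (if false then ((if ((la ∧ ¬ sa' ∧ ¬ sb ∧ lb') ∨ (la' ∧ ¬ sa ∧ ¬ sb' ∧ lb)) then (1:ℤ) else 0)
                        - (if (ua ∧ ¬ sa' ∧ ¬ sb ∧ ub') then (1:ℤ) else 0)) else 0) := by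
  decide
set_option synthInstance.maxSize 100000 in
/-- mainP1, case `zt = false`, `inzt = true` (`decide`, fourteen Booleans). -/
private theorem mainP1_ft : ∀ (a0 b0' a' b ua ub' sa sa' sb sb' la la' lb lb' : Bool),
    (la = true → sa = true) → (la' = true → sa' = true) → (lb = true → sb = true) → (lb' = true → sb' = true) → (la' = true → a' = true) → (lb = true → b = true) →
    (a0 = true → ua = true) → (b0' = true → ub' = true) → (a0 = true → sa = true) → (b0' = true → sb' = true) →
    0 ≤ (1 - (if (a0 ∧ b0') then (1:ℤ) else 0))
        - (if true then (if (¬ a' ∧ ¬ b ∧ ¬ ((ua ∨ la) ∧ (ub' ∨ lb'))) then (1:ℤ) else 0) else 0)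
        - (if false then ((if ((la ∧ ¬ sa' ∧ ¬ sb ∧ lb') ∨ (la' ∧ ¬ sa ∧ ¬ sb' ∧ lb)) then (1:ℤ) else 0)
                        - (if (ua ∧ ¬ sa' ∧ ¬ sb ∧ ub') then (1:ℤ) else 0)) else 0) := by
  decide
set_option synthInstance.maxSize 100000 in
/-- mainP1, case `zt = true`, `inzt = false` (`decide`, fourteen Booleans). -/
private theorem mainP1_tf : ∀ (a0 b0' a' b ua ub' sa sa' sb sb' la la' lb lb' : Bool),
    (la = true → sa = true) → (la' = true → sa' = true) → (lb = true → sb = true) → (lb' = true → sb' = true) → (la' = true → a' = true) → (lb = true → b = true) →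
    (a0 = true → ua = true) → (b0' = true → ub' = true) → (a0 = true → sa = true) → (b0' = true → sb' = true) →
    0 ≤ (1 - (if (a0 ∧ b0') then (1:ℤ) else 0))
        - (if false then (if (¬ a' ∧ ¬ b ∧ ¬ ((ua ∨ la) ∧ (ub' ∨ lb'))) then (1:ℤ) else 0) else 0)
        - (if true then ((if ((la ∧ ¬ sa' ∧ ¬ sb ∧ lb') ∨ (la' ∧ ¬ sa ∧ ¬ sb' ∧ lb)) then (1:ℤ) else 0)
                        - (if (ua ∧ ¬ sa' ∧ ¬ sb ∧ ub') then (1:ℤ) else 0)) else 0) := by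
  decide
set_option synthInstance.maxSize 100000 in
/-- mainP1, case `zt = true`, `inzt = true` (`decide`, fourteen Booleans). -/
private theorem mainP1_tt : ∀ (a0 b0' a' b ua ub' sa sa' sb sb' la la' lb lb' : Bool),
    (la = true → sa = true) → (la' = true → sa' = true) → (lb = true → sb = true) → (lb' = true → sb' = true) → (la' = true → a' = true) → (lb = true → b = true) →
    (a0 = true → ua = true) → (b0' = true → ub' = true) → (a0 = true → sa = true) → (b0' = true → sb' = true) →
    0 ≤ (1 - (if (a0 ∧ b0') then (1:ℤ) else 0))
        - (if true then (if (¬ a' ∧ ¬ b ∧ ¬ ((ua ∨ la) ∧ (ub' ∨ lb'))) then (1:ℤ) else 0) else 0)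
        - (if true then ((if ((la ∧ ¬ sa' ∧ ¬ sb ∧ lb') ∨ (la' ∧ ¬ sa ∧ ¬ sb' ∧ lb)) then (1:ℤ) else 0)
                        - (if (ua ∧ ¬ sa' ∧ ¬ sb ∧ ub') then (1:ℤ) else 0)) else 0) := by
  decide

/-- phase 1, the pointwise budget: `(1 − [A0∩B0']) − [γ∈ZT]·[deficient, no route] − [γ∈ZTT]·(c_old − c_new⁽¹⁾) ≥ 0` under the realizable
constraints (`decide`, sixteen Booleans). -/
private theorem mainP1 : ∀ (zt inzt a0 b0' a' b ua ub' sa sa' sb sb' la la' lb lb' : Bool),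
    (la = true → sa = true) → (la' = true → sa' = true) → (lb = true → sb = true) → (lb' = true → sb' = true) → (la' = true → a' = true) → (lb = true → b = true) →
    (a0 = true → ua = true) → (b0' = true → ub' = true) → (a0 = true → sa = true) → (b0' = true → sb' = true) →
    0 ≤ (1 - (if (a0 ∧ b0') then (1:ℤ) else 0))
        - (if inzt then (if (¬ a' ∧ ¬ b ∧ ¬ ((ua ∨ la) ∧ (ub' ∨ lb'))) then (1:ℤ) else 0) else 0)
        - (if zt then ((if ((la ∧ ¬ sa' ∧ ¬ sb ∧ lb') ∨ (la' ∧ ¬ sa ∧ ¬ sb' ∧ lb)) then (1:ℤ) else 0)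
                        - (if (ua ∧ ¬ sa' ∧ ¬ sb ∧ ub') then (1:ℤ) else 0)) else 0) := by
  intro zt inzt; cases zt <;> cases inzt
  · exact mainP1_ff
  · exact mainP1_ft
  · exact mainP1_tf
  · exact mainP1_tt
set_option synthInstance.maxSize 100000 in
/-- mainP2, case `zt = false`, `inzt = false` (`decide`, fourteen Booleans). -/
private theorem mainP2_ff : ∀ (a0' b0 a b' ua' ub sa sa' sb sb' la la' lb lb' : Bool),
    (la = true → sa = true) → (la' = true → sa' = true) → (lb = true → sb = true) → (lb' = true → sb' = true) → (la = true → a = true) → (lb' = true → b' = true) →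
    (a0' = true → ua' = true) → (b0 = true → ub = true) → (a0' = true → sa' = true) → (b0 = true → sb = true) →
    0 ≤ (1 - (if (a0' ∧ b0) then (1:ℤ) else 0))
        - (if false then (if (¬ a ∧ ¬ b' ∧ ¬ ((ua' ∨ la') ∧ (ub ∨ lb))) then (1:ℤ) else 0) else 0)
        - (if false then ((if ((la ∧ ¬ sa' ∧ ¬ sb ∧ lb') ∨ (la' ∧ ¬ sa ∧ ¬ sb' ∧ lb)) then (1:ℤ) else 0)
                        - (if (ua' ∧ ¬ sa ∧ ¬ sb' ∧ ub) then (1:ℤ) else 0)) else 0) := by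
  decide
set_option synthInstance.maxSize 100000 in
/-- mainP2, case `zt = false`, `inzt = true` (`decide`, fourteen Booleans). -/
private theorem mainP2_ft : ∀ (a0' b0 a b' ua' ub sa sa' sb sb' la la' lb lb' : Bool),
    (la = true → sa = true) → (la' = true → sa' = true) → (lb = true → sb = true) → (lb' = true → sb' = true) → (la = true → a = true) → (lb' = true → b' = true) →
    (a0' = true → ua' = true) → (b0 = true → ub = true) → (a0' = true → sa' = true) → (b0 = true → sb = true) →
    0 ≤ (1 - (if (a0' ∧ b0) then (1:ℤ) else 0))
        - (if true then (if (¬ a ∧ ¬ b' ∧ ¬ ((ua' ∨ la') ∧ (ub ∨ lb))) then (1:ℤ) else 0) else 0)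
        - (if false then ((if ((la ∧ ¬ sa' ∧ ¬ sb ∧ lb') ∨ (la' ∧ ¬ sa ∧ ¬ sb' ∧ lb)) then (1:ℤ) else 0)
                        - (if (ua' ∧ ¬ sa ∧ ¬ sb' ∧ ub) then (1:ℤ) else 0)) else 0) := by
  decide
set_option synthInstance.maxSize 100000 in
/-- mainP2, case `zt = true`, `inzt = false` (`decide`, fourteen Booleans). -/
private theorem mainP2_tf : ∀ (a0' b0 a b' ua' ub sa sa' sb sb' la la' lb lb' : Bool),
    (la = true → sa = true) → (la' = true → sa' = true) → (lb = true → sb = true) → (lb' = true → sb' = true) → (la = true → a = true) → (lb' = true → b' = true) →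
    (a0' = true → ua' = true) → (b0 = true → ub = true) → (a0' = true → sa' = true) → (b0 = true → sb = true) →
    0 ≤ (1 - (if (a0' ∧ b0) then (1:ℤ) else 0))
        - (if false then (if (¬ a ∧ ¬ b' ∧ ¬ ((ua' ∨ la') ∧ (ub ∨ lb))) then (1:ℤ) else 0) else 0)
        - (if true then ((if ((la ∧ ¬ sa' ∧ ¬ sb ∧ lb') ∨ (la' ∧ ¬ sa ∧ ¬ sb' ∧ lb)) then (1:ℤ) else 0)
                        - (if (ua' ∧ ¬ sa ∧ ¬ sb' ∧ ub) then (1:ℤ) else 0)) else 0) := by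
  decide
set_option synthInstance.maxSize 100000 in
/-- mainP2, case `zt = true`, `inzt = true` (`decide`, fourteen Booleans). -/
private theorem mainP2_tt : ∀ (a0' b0 a b' ua' ub sa sa' sb sb' la la' lb lb' : Bool),
    (la = true → sa = true) → (la' = true → sa' = true) → (lb = true → sb = true) → (lb' = true → sb' = true) → (la = true → a = true) → (lb' = true → b' = true) →
    (a0' = true → ua' = true) → (b0 = true → ub = true) → (a0' = true → sa' = true) → (b0 = true → sb = true) →
    0 ≤ (1 - (if (a0' ∧ b0) then (1:ℤ) else 0))
        - (if true then (if (¬ a ∧ ¬ b' ∧ ¬ ((ua' ∨ la') ∧ (ub ∨ lb))) then (1:ℤ) else 0) else 0)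
        - (if true then ((if ((la ∧ ¬ sa' ∧ ¬ sb ∧ lb') ∨ (la' ∧ ¬ sa ∧ ¬ sb' ∧ lb)) then (1:ℤ) else 0)
                        - (if (ua' ∧ ¬ sa ∧ ¬ sb' ∧ ub) then (1:ℤ) else 0)) else 0) := by
  decide

/-- phase 2, the pointwise budget (`decide`, sixteen Booleans). -/
private theorem mainP2 : ∀ (zt inzt a0' b0 a b' ua' ub sa sa' sb sb' la la' lb lb' : Bool),
    (la = true → sa = true) → (la' = true → sa' = true) → (lb = true → sb = true) → (lb' = true → sb' = true) → (la = true → a = true) → (lb' = true → b' = true) →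
    (a0' = true → ua' = true) → (b0 = true → ub = true) → (a0' = true → sa' = true) → (b0 = true → sb = true) →
    0 ≤ (1 - (if (a0' ∧ b0) then (1:ℤ) else 0))
        - (if inzt then (if (¬ a ∧ ¬ b' ∧ ¬ ((ua' ∨ la') ∧ (ub ∨ lb))) then (1:ℤ) else 0) else 0)
        - (if zt then ((if ((la ∧ ¬ sa' ∧ ¬ sb ∧ lb') ∨ (la' ∧ ¬ sa ∧ ¬ sb' ∧ lb)) then (1:ℤ) else 0)
                        - (if (ua' ∧ ¬ sa ∧ ¬ sb' ∧ ub) then (1:ℤ) else 0)) else 0) := by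
  intro zt inzt; cases zt <;> cases inzt
  · exact mainP2_ff
  · exact mainP2_ft
  · exact mainP2_tf
  · exact mainP2_tt
set_option synthInstance.maxSize 100000 in
/-- tops with bonus dominate minus the deficit indicator of THEOREM Q: `q⁺_top ≥ −[q_top < 0]` (`decide`). -/
private theorem topN : ∀ (a a' b b' ua ua' ub ub' la la' lb lb' : Bool),
    - (if (((if a then (1:ℤ) else 0) - (if a' then (1:ℤ) else 0)) * ((if b then (1:ℤ) else 0) - (if b' then (1:ℤ) else 0))
            + (if ((ua ∧ ¬ a' ∧ ¬ b ∧ ub') ∨ (ua' ∧ ¬ a ∧ ub ∧ ¬ b')) then (1:ℤ) else 0)) < 0 then (1:ℤ) else 0) ≤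
      (((if a then (1:ℤ) else 0) - (if a' then (1:ℤ) else 0)) * ((if b then (1:ℤ) else 0) - (if b' then (1:ℤ) else 0))
        + (if ((((ua ∨ la) ∧ ¬ a' ∧ ¬ b ∧ (ub' ∨ lb')) ∨ ((ua' ∨ la') ∧ ¬ a ∧ (ub ∨ lb) ∧ ¬ b'))) then (1:ℤ) else 0)) := by
  decide

variable {α : Type*} [Fintype α] [DecidableEq α]

/-- **THEOREM Q⁺ (the relative hub lemma RHL for brooms, abstract form, all `r`).**  Data as in `AntitheticPureBroom.broom_lpure`
(`α` = red-leaf sets, `bar` an involution, bottom parts `A0,A0',B0,B0'`, top parts `A,A',B,B'` with `X0 ≠ ∅ ⟹ X = univ`, up-closures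
`UA ⊇ A0,…`), a down-set (`ZB ⊆` bottoms, `ZT ⊆` tops, `ZT ≠ ∅ ⟹ ZB = univ`), and for the `F′`-top above each top `γ` its memberships
`SA,SA',SB,SB'`, its `α`-routes `LA ⊆ SA,…`, and the charged set `ZTT`, with the realizable constraints (C2) `A0 ≠ ∅ ⟹ SA = univ` (etc.),
(C3) `ZTT ≠ ∅ ⟹ ZB = univ`, (C5) `LA ≠ ∅ ⟹ A = univ` (etc.).  Then the level functional of the GENERAL HUB IDENTITY is nonnegative:
`0 ≤ Σ_{γ∈ZB} q_bot γ + Σ_{γ∈ZT} q⁺_top γ − Σ_{γ∈ZTT} (c_old γ − c_new γ)`, where `q⁺_top` is the top value with the extra `α`-routes and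
`c_old`, `c_new` are the certificate of the `F′`-top before/after the hub step. [this work] -/
theorem broom_rhl (bar : α → α) (hbar : Function.Involutive bar)
    (A0 A0' B0 B0' A A' B B' UA UA' UB UB' : Finset α)
    (hA : A0.Nonempty → A = univ) (hA' : A0'.Nonempty → A' = univ) (hB : B0.Nonempty → B = univ) (hB' : B0'.Nonempty → B' = univ)
    (hUA : A0 ⊆ UA) (hUA' : A0' ⊆ UA') (hUB : B0 ⊆ UB) (hUB' : B0' ⊆ UB')
    (ZB ZT : Finset α) (hZ : ZT.Nonempty → ZB = univ)
    (SA SA' SB SB' LA LA' LB LB' ZTT : Finset α)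
    (hLSA : LA ⊆ SA) (hLSA' : LA' ⊆ SA') (hLSB : LB ⊆ SB) (hLSB' : LB' ⊆ SB')
    (hSA : A0.Nonempty → SA = univ) (hSA' : A0'.Nonempty → SA' = univ) (hSB : B0.Nonempty → SB = univ) (hSB' : B0'.Nonempty → SB' = univ)
    (hZTT : ZTT.Nonempty → ZB = univ)
    (hLA : LA.Nonempty → A = univ) (hLA' : LA'.Nonempty → A' = univ) (hLB : LB.Nonempty → B = univ) (hLB' : LB'.Nonempty → B' = univ) :
    0 ≤ (∑ γ ∈ ZB,
          (((if γ ∈ A0 then (1:ℤ) else 0) - (if γ ∈ A0' then (1:ℤ) else 0)) * ((if γ ∈ B0 then (1:ℤ) else 0) - (if γ ∈ B0' then (1:ℤ) else 0))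
            + (if ((bar γ ∈ A ∧ γ ∉ A0' ∧ γ ∉ B0 ∧ bar γ ∈ B') ∨ (bar γ ∈ A' ∧ γ ∉ A0 ∧ bar γ ∈ B ∧ γ ∉ B0')) then (1:ℤ) else 0)))
        + (∑ γ ∈ ZT,
          (((if γ ∈ A then (1:ℤ) else 0) - (if γ ∈ A' then (1:ℤ) else 0)) * ((if γ ∈ B then (1:ℤ) else 0) - (if γ ∈ B' then (1:ℤ) else 0))
            + (if ((((γ ∈ UA ∨ γ ∈ LA) ∧ γ ∉ A' ∧ γ ∉ B ∧ (γ ∈ UB' ∨ γ ∈ LB')) ∨ ((γ ∈ UA' ∨ γ ∈ LA') ∧ γ ∉ A ∧ (γ ∈ UB ∨ γ ∈ LB) ∧ γ ∉ B'))) then (1:ℤ) else 0)))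
        - (∑ γ ∈ ZTT,
          ((if ((γ ∈ LA ∧ γ ∉ SA' ∧ γ ∉ SB ∧ γ ∈ LB') ∨ (γ ∈ LA' ∧ γ ∉ SA ∧ γ ∉ SB' ∧ γ ∈ LB)) then (1:ℤ) else 0)
            - (if ((γ ∈ UA ∧ γ ∉ SA' ∧ γ ∉ SB ∧ γ ∈ UB') ∨ (γ ∈ UA' ∧ γ ∉ SA ∧ γ ∉ SB' ∧ γ ∈ UB)) then (1:ℤ) else 0))) := by
  -- names for the three summands
  set qb : α → ℤ := fun γ =>
    (((if γ ∈ A0 then (1:ℤ) else 0) - (if γ ∈ A0' then (1:ℤ) else 0)) * ((if γ ∈ B0 then (1:ℤ) else 0) - (if γ ∈ B0' then (1:ℤ) else 0))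
      + (if ((bar γ ∈ A ∧ γ ∉ A0' ∧ γ ∉ B0 ∧ bar γ ∈ B') ∨ (bar γ ∈ A' ∧ γ ∉ A0 ∧ bar γ ∈ B ∧ γ ∉ B0')) then (1:ℤ) else 0)) with hqb
  set qt : α → ℤ := fun γ =>
    (((if γ ∈ A then (1:ℤ) else 0) - (if γ ∈ A' then (1:ℤ) else 0)) * ((if γ ∈ B then (1:ℤ) else 0) - (if γ ∈ B' then (1:ℤ) else 0))
      + (if ((((γ ∈ UA ∨ γ ∈ LA) ∧ γ ∉ A' ∧ γ ∉ B ∧ (γ ∈ UB' ∨ γ ∈ LB')) ∨ ((γ ∈ UA' ∨ γ ∈ LA') ∧ γ ∉ A ∧ (γ ∈ UB ∨ γ ∈ LB) ∧ γ ∉ B'))) then (1:ℤ) else 0)) with hqt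
  set ls : α → ℤ := fun γ =>
    ((if ((γ ∈ LA ∧ γ ∉ SA' ∧ γ ∉ SB ∧ γ ∈ LB') ∨ (γ ∈ LA' ∧ γ ∉ SA ∧ γ ∉ SB' ∧ γ ∈ LB)) then (1:ℤ) else 0)
      - (if ((γ ∈ UA ∧ γ ∉ SA' ∧ γ ∉ SB ∧ γ ∈ UB') ∨ (γ ∈ UA' ∧ γ ∉ SA ∧ γ ∉ SB' ∧ γ ∈ UB)) then (1:ℤ) else 0)) with hls
  show 0 ≤ (∑ γ ∈ ZB, qb γ) + (∑ γ ∈ ZT, qt γ) - (∑ γ ∈ ZTT, ls γ)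
  -- pointwise facts available everywhere
  have gA : ∀ δ, A0.Nonempty → decide (δ ∈ A) = true := fun δ h => by simp [hA h]
  have gA' : ∀ δ, A0'.Nonempty → decide (δ ∈ A') = true := fun δ h => by simp [hA' h]
  have gB : ∀ δ, B0.Nonempty → decide (δ ∈ B) = true := fun δ h => by simp [hB h]
  have gB' : ∀ δ, B0'.Nonempty → decide (δ ∈ B') = true := fun δ h => by simp [hB' h]
  have fA0 : ∀ γ, decide (γ ∈ A0) = true → A0.Nonempty := fun γ h => ⟨γ, by simpa using h⟩
  have fA0' : ∀ γ, decide (γ ∈ A0') = true → A0'.Nonempty := fun γ h => ⟨γ, by simpa using h⟩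
  have fB0 : ∀ γ, decide (γ ∈ B0) = true → B0.Nonempty := fun γ h => ⟨γ, by simpa using h⟩
  have fB0' : ∀ γ, decide (γ ∈ B0') = true → B0'.Nonempty := fun γ h => ⟨γ, by simpa using h⟩
  have hqb0 : ∀ γ, 0 ≤ qb γ := by
    intro γ
    have key := botN (decide (γ ∈ A0)) (decide (γ ∈ A0')) (decide (γ ∈ B0)) (decide (γ ∈ B0')) (decide (bar γ ∈ A)) (decide (bar γ ∈ A')) (decide (bar γ ∈ B)) (decide (bar γ ∈ B')) (fun h => gA (bar γ) (fA0 γ h)) (fun h => gA' (bar γ) (fA0' γ h)) (fun h => gB (bar γ) (fB0 γ h)) (fun h => gB' (bar γ) (fB0' γ h))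
    simpa only [hqb, decide_eq_true_eq, Bool.decide_and, Bool.decide_or, decide_not] using key
  -- realizable implications used pointwise
  have iLSA : ∀ γ, decide (γ ∈ LA) = true → decide (γ ∈ SA) = true := fun γ h => by simpa using hLSA (by simpa using h)
  have iLSA' : ∀ γ, decide (γ ∈ LA') = true → decide (γ ∈ SA') = true := fun γ h => by simpa using hLSA' (by simpa using h)
  have iLSB : ∀ γ, decide (γ ∈ LB) = true → decide (γ ∈ SB) = true := fun γ h => by simpa using hLSB (by simpa using h)
  have iLSB' : ∀ γ, decide (γ ∈ LB') = true → decide (γ ∈ SB') = true := fun γ h => by simpa using hLSB' (by simpa using h)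
  have iLA : ∀ γ, decide (γ ∈ LA) = true → decide (γ ∈ A) = true := fun γ h => by have hne : LA.Nonempty := ⟨γ, by simpa using h⟩; simp [hLA hne]
  have iLA' : ∀ γ, decide (γ ∈ LA') = true → decide (γ ∈ A') = true := fun γ h => by have hne : LA'.Nonempty := ⟨γ, by simpa using h⟩; simp [hLA' hne]
  have iLB : ∀ γ, decide (γ ∈ LB) = true → decide (γ ∈ B) = true := fun γ h => by have hne : LB.Nonempty := ⟨γ, by simpa using h⟩; simp [hLB hne]
  have iLB' : ∀ γ, decide (γ ∈ LB') = true → decide (γ ∈ B') = true := fun γ h => by have hne : LB'.Nonempty := ⟨γ, by simpa using h⟩; simp [hLB' hne]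
  have iUA : ∀ γ, decide (γ ∈ A0) = true → decide (γ ∈ UA) = true := fun γ h => by simpa using hUA (by simpa using h)
  have iUA' : ∀ γ, decide (γ ∈ A0') = true → decide (γ ∈ UA') = true := fun γ h => by simpa using hUA' (by simpa using h)
  have iUB : ∀ γ, decide (γ ∈ B0) = true → decide (γ ∈ UB) = true := fun γ h => by simpa using hUB (by simpa using h)
  have iUB' : ∀ γ, decide (γ ∈ B0') = true → decide (γ ∈ UB') = true := fun γ h => by simpa using hUB' (by simpa using h)
  have iSA : ∀ γ, decide (γ ∈ A0) = true → decide (γ ∈ SA) = true := fun γ h => by simp [hSA (fA0 γ h)]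
  have iSA' : ∀ γ, decide (γ ∈ A0') = true → decide (γ ∈ SA') = true := fun γ h => by simp [hSA' (fA0' γ h)]
  have iSB : ∀ γ, decide (γ ∈ B0) = true → decide (γ ∈ SB) = true := fun γ h => by simp [hSB (fB0 γ h)]
  have iSB' : ∀ γ, decide (γ ∈ B0') = true → decide (γ ∈ SB') = true := fun γ h => by simp [hSB' (fB0' γ h)]
  -- the two loss routes are bounded by the loss (used in both phases)
  have lossle1 : ∀ γ, ls γ ≤ (if ((γ ∈ LA ∧ γ ∉ SA' ∧ γ ∉ SB ∧ γ ∈ LB') ∨ (γ ∈ LA' ∧ γ ∉ SA ∧ γ ∉ SB' ∧ γ ∈ LB)) then (1:ℤ) else 0)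
        - (if (γ ∈ UA ∧ γ ∉ SA' ∧ γ ∉ SB ∧ γ ∈ UB') then (1:ℤ) else 0) := by
    intro γ
    have key := cnew1_le (decide (γ ∈ UA)) (decide (γ ∈ UA')) (decide (γ ∈ UB)) (decide (γ ∈ UB')) (decide (γ ∈ SA)) (decide (γ ∈ SA')) (decide (γ ∈ SB)) (decide (γ ∈ SB'))
    have k2 : (if (γ ∈ UA ∧ γ ∉ SA' ∧ γ ∉ SB ∧ γ ∈ UB') then (1:ℤ) else 0) ≤
        (if ((γ ∈ UA ∧ γ ∉ SA' ∧ γ ∉ SB ∧ γ ∈ UB') ∨ (γ ∈ UA' ∧ γ ∉ SA ∧ γ ∉ SB' ∧ γ ∈ UB)) then (1:ℤ) else 0) := by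
      simpa only [decide_eq_true_eq, Bool.decide_and, Bool.decide_or, decide_not] using key
    simp only [hls]
    linarith
  have lossle2 : ∀ γ, ls γ ≤ (if ((γ ∈ LA ∧ γ ∉ SA' ∧ γ ∉ SB ∧ γ ∈ LB') ∨ (γ ∈ LA' ∧ γ ∉ SA ∧ γ ∉ SB' ∧ γ ∈ LB)) then (1:ℤ) else 0)
        - (if (γ ∈ UA' ∧ γ ∉ SA ∧ γ ∉ SB' ∧ γ ∈ UB) then (1:ℤ) else 0) := by
    intro γ
    have key := cnew2_le (decide (γ ∈ UA)) (decide (γ ∈ UA')) (decide (γ ∈ UB)) (decide (γ ∈ UB')) (decide (γ ∈ SA)) (decide (γ ∈ SA')) (decide (γ ∈ SB)) (decide (γ ∈ SB'))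
    have k2 : (if (γ ∈ UA' ∧ γ ∉ SA ∧ γ ∉ SB' ∧ γ ∈ UB) then (1:ℤ) else 0) ≤
        (if ((γ ∈ UA ∧ γ ∉ SA' ∧ γ ∉ SB ∧ γ ∈ UB') ∨ (γ ∈ UA' ∧ γ ∉ SA ∧ γ ∉ SB' ∧ γ ∈ UB)) then (1:ℤ) else 0) := by
      simpa only [decide_eq_true_eq, Bool.decide_and, Bool.decide_or, decide_not] using key
    simp only [hls]
    linarith
  -- rewriting a sum over a subset of `univ` as a sum of an indicator
  have sumsub : ∀ (S : Finset α) (f : α → ℤ), (∑ γ ∈ S, f γ) = ∑ γ : α, (if γ ∈ S then f γ else 0) := by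
    intro S f
    rw [← Finset.sum_filter]
    congr 1
    ext γ; simp
  -- PHASE 1: a charged type-1 loss exists
  by_cases h1 : ∃ γ₀, γ₀ ∈ ZTT ∧ γ₀ ∈ LA ∧ γ₀ ∉ SA' ∧ γ₀ ∉ SB ∧ γ₀ ∈ LB'
  · obtain ⟨γ₀, h0Z, h0LA, h0SA', h0SB, h0LB'⟩ := h1
    have hAu : A = univ := hLA ⟨γ₀, h0LA⟩
    have hB'u : B' = univ := hLB' ⟨γ₀, h0LB'⟩
    have hA0'e : A0' = ∅ := (Finset.eq_empty_or_nonempty A0').resolve_right (fun h => h0SA' (by rw [hSA' h]; exact mem_univ _))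
    have hB0e : B0 = ∅ := (Finset.eq_empty_or_nonempty B0).resolve_right (fun h => h0SB (by rw [hSB h]; exact mem_univ _))
    have hZBu : ZB = univ := hZTT ⟨γ₀, h0Z⟩
    rw [hZBu, sumsub ZT qt, sumsub ZTT ls, ← Finset.sum_add_distrib, ← Finset.sum_sub_distrib]; refine Finset.sum_nonneg (fun γ _ => ?_)
    obtain ⟨xa, xb', ya, yb', na0', nb0⟩ : decide (bar γ ∈ A) = true ∧ decide (bar γ ∈ B') = true ∧ decide (γ ∈ A) = true ∧ decide (γ ∈ B') = true ∧
        decide (γ ∈ A0') = false ∧ decide (γ ∈ B0) = false := ⟨by simp [hAu], by simp [hB'u], by simp [hAu], by simp [hB'u], by simp [hA0'e], by simp [hB0e]⟩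
    have e1 := botP1 (decide (γ ∈ A0)) (decide (γ ∈ A0')) (decide (γ ∈ B0)) (decide (γ ∈ B0')) (decide (bar γ ∈ A)) (decide (bar γ ∈ A')) (decide (bar γ ∈ B)) (decide (bar γ ∈ B')) xa xb' na0' nb0
    have e1' : 1 - (if (γ ∈ A0 ∧ γ ∈ B0') then (1:ℤ) else 0) ≤ qb γ := by
      simpa only [hqb, decide_eq_true_eq, Bool.decide_and, Bool.decide_or, decide_not] using e1
    have e2 := topP1 (decide (γ ∈ A)) (decide (γ ∈ A')) (decide (γ ∈ B)) (decide (γ ∈ B')) (decide (γ ∈ UA)) (decide (γ ∈ UA')) (decide (γ ∈ UB)) (decide (γ ∈ UB')) (decide (γ ∈ LA)) (decide (γ ∈ LA')) (decide (γ ∈ LB)) (decide (γ ∈ LB')) ya yb'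
    have e2' : - (if (γ ∉ A' ∧ γ ∉ B ∧ ¬ ((γ ∈ UA ∨ γ ∈ LA) ∧ (γ ∈ UB' ∨ γ ∈ LB'))) then (1:ℤ) else 0) ≤ qt γ := by
      simpa only [hqt, decide_eq_true_eq, Bool.decide_and, Bool.decide_or, decide_not] using e2
    have e3 := lossle1 γ
    have e4 := mainP1 (decide (γ ∈ ZTT)) (decide (γ ∈ ZT)) (decide (γ ∈ A0)) (decide (γ ∈ B0')) (decide (γ ∈ A')) (decide (γ ∈ B)) (decide (γ ∈ UA)) (decide (γ ∈ UB')) (decide (γ ∈ SA)) (decide (γ ∈ SA')) (decide (γ ∈ SB)) (decide (γ ∈ SB')) (decide (γ ∈ LA)) (decide (γ ∈ LA')) (decide (γ ∈ LB)) (decide (γ ∈ LB')) (iLSA γ) (iLSA' γ) (iLSB γ) (iLSB' γ) (iLA' γ) (iLB γ) (iUA γ) (iUB' γ) (iSA γ) (iSB' γ)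
    have e4' : 0 ≤ (1 - (if (γ ∈ A0 ∧ γ ∈ B0') then (1:ℤ) else 0))
        - (if γ ∈ ZT then (if (γ ∉ A' ∧ γ ∉ B ∧ ¬ ((γ ∈ UA ∨ γ ∈ LA) ∧ (γ ∈ UB' ∨ γ ∈ LB'))) then (1:ℤ) else 0) else 0)
        - (if γ ∈ ZTT then ((if ((γ ∈ LA ∧ γ ∉ SA' ∧ γ ∉ SB ∧ γ ∈ LB') ∨ (γ ∈ LA' ∧ γ ∉ SA ∧ γ ∉ SB' ∧ γ ∈ LB)) then (1:ℤ) else 0)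
                        - (if (γ ∈ UA ∧ γ ∉ SA' ∧ γ ∉ SB ∧ γ ∈ UB') then (1:ℤ) else 0)) else 0) := by
      simpa only [decide_eq_true_eq, Bool.decide_and, Bool.decide_or, decide_not] using e4
    by_cases hzT : γ ∈ ZT <;> by_cases hzTT : γ ∈ ZTT <;> simp only [hzT, hzTT, if_true, if_false] at e4' ⊢ <;> linarith
  -- PHASE 2: a charged type-2 loss exists
  by_cases h2 : ∃ γ₀, γ₀ ∈ ZTT ∧ γ₀ ∈ LA' ∧ γ₀ ∉ SA ∧ γ₀ ∉ SB' ∧ γ₀ ∈ LB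
  · obtain ⟨γ₀, h0Z, h0LA', h0SA, h0SB', h0LB⟩ := h2
    have hA'u : A' = univ := hLA' ⟨γ₀, h0LA'⟩
    have hBu : B = univ := hLB ⟨γ₀, h0LB⟩
    have hA0e : A0 = ∅ := (Finset.eq_empty_or_nonempty A0).resolve_right (fun h => h0SA (by rw [hSA h]; exact mem_univ _))
    have hB0'e : B0' = ∅ := (Finset.eq_empty_or_nonempty B0').resolve_right (fun h => h0SB' (by rw [hSB' h]; exact mem_univ _))
    have hZBu : ZB = univ := hZTT ⟨γ₀, h0Z⟩
    rw [hZBu, sumsub ZT qt, sumsub ZTT ls, ← Finset.sum_add_distrib, ← Finset.sum_sub_distrib]; refine Finset.sum_nonneg (fun γ _ => ?_)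
    obtain ⟨xa', xb, ya', yb, na0, nb0'⟩ : decide (bar γ ∈ A') = true ∧ decide (bar γ ∈ B) = true ∧ decide (γ ∈ A') = true ∧ decide (γ ∈ B) = true ∧
        decide (γ ∈ A0) = false ∧ decide (γ ∈ B0') = false := ⟨by simp [hA'u], by simp [hBu], by simp [hA'u], by simp [hBu], by simp [hA0e], by simp [hB0'e]⟩
    have e1 := botP2 (decide (γ ∈ A0)) (decide (γ ∈ A0')) (decide (γ ∈ B0)) (decide (γ ∈ B0')) (decide (bar γ ∈ A)) (decide (bar γ ∈ A')) (decide (bar γ ∈ B)) (decide (bar γ ∈ B')) xa' xb na0 nb0'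
    have e1' : 1 - (if (γ ∈ A0' ∧ γ ∈ B0) then (1:ℤ) else 0) ≤ qb γ := by
      simpa only [hqb, decide_eq_true_eq, Bool.decide_and, Bool.decide_or, decide_not] using e1
    have e2 := topP2 (decide (γ ∈ A)) (decide (γ ∈ A')) (decide (γ ∈ B)) (decide (γ ∈ B')) (decide (γ ∈ UA)) (decide (γ ∈ UA')) (decide (γ ∈ UB)) (decide (γ ∈ UB')) (decide (γ ∈ LA)) (decide (γ ∈ LA')) (decide (γ ∈ LB)) (decide (γ ∈ LB')) ya' yb
    have e2' : - (if (γ ∉ A ∧ γ ∉ B' ∧ ¬ ((γ ∈ UA' ∨ γ ∈ LA') ∧ (γ ∈ UB ∨ γ ∈ LB))) then (1:ℤ) else 0) ≤ qt γ := by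
      simpa only [hqt, decide_eq_true_eq, Bool.decide_and, Bool.decide_or, decide_not] using e2
    have e3 := lossle2 γ
    have e4 := mainP2 (decide (γ ∈ ZTT)) (decide (γ ∈ ZT)) (decide (γ ∈ A0')) (decide (γ ∈ B0)) (decide (γ ∈ A)) (decide (γ ∈ B')) (decide (γ ∈ UA')) (decide (γ ∈ UB)) (decide (γ ∈ SA)) (decide (γ ∈ SA')) (decide (γ ∈ SB)) (decide (γ ∈ SB')) (decide (γ ∈ LA)) (decide (γ ∈ LA')) (decide (γ ∈ LB)) (decide (γ ∈ LB')) (iLSA γ) (iLSA' γ) (iLSB γ) (iLSB' γ) (iLA γ) (iLB' γ) (iUA' γ) (iUB γ) (iSA' γ) (iSB γ)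
    have e4' : 0 ≤ (1 - (if (γ ∈ A0' ∧ γ ∈ B0) then (1:ℤ) else 0))
        - (if γ ∈ ZT then (if (γ ∉ A ∧ γ ∉ B' ∧ ¬ ((γ ∈ UA' ∨ γ ∈ LA') ∧ (γ ∈ UB ∨ γ ∈ LB))) then (1:ℤ) else 0) else 0)
        - (if γ ∈ ZTT then ((if ((γ ∈ LA ∧ γ ∉ SA' ∧ γ ∉ SB ∧ γ ∈ LB') ∨ (γ ∈ LA' ∧ γ ∉ SA ∧ γ ∉ SB' ∧ γ ∈ LB)) then (1:ℤ) else 0)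
                        - (if (γ ∈ UA' ∧ γ ∉ SA ∧ γ ∉ SB' ∧ γ ∈ UB) then (1:ℤ) else 0)) else 0) := by
      simpa only [decide_eq_true_eq, Bool.decide_and, Bool.decide_or, decide_not] using e4
    by_cases hzT : γ ∈ ZT <;> by_cases hzTT : γ ∈ ZTT <;> simp only [hzT, hzTT, if_true, if_false] at e4' ⊢ <;> linarith
  -- NO CHARGED LOSS: losses are ≤ 0, the bonus is ≥ 0, THEOREM Q applies
  have hls0 : ∀ γ ∈ ZTT, ls γ ≤ 0 := by
    intro γ hγ
    have c1 : ¬ (γ ∈ LA ∧ γ ∉ SA' ∧ γ ∉ SB ∧ γ ∈ LB') := fun h => h1 ⟨γ, hγ, h.1, h.2.1, h.2.2.1, h.2.2.2⟩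
    have c2 : ¬ (γ ∈ LA' ∧ γ ∉ SA ∧ γ ∉ SB' ∧ γ ∈ LB) := fun h => h2 ⟨γ, hγ, h.1, h.2.1, h.2.2.1, h.2.2.2⟩
    have hc : (if ((γ ∈ LA ∧ γ ∉ SA' ∧ γ ∉ SB ∧ γ ∈ LB') ∨ (γ ∈ LA' ∧ γ ∉ SA ∧ γ ∉ SB' ∧ γ ∈ LB)) then (1:ℤ) else 0) = 0 := by
      simp only [c1, c2, or_self, if_false]
    simp only [hls, hc]
    split_ifs <;> norm_num
  have hL : (∑ γ ∈ ZTT, ls γ) ≤ 0 := Finset.sum_nonpos hls0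
  -- the deficit indicator of THEOREM Q
  set dt : α → ℤ := fun γ =>
    (if (((if γ ∈ A then (1:ℤ) else 0) - (if γ ∈ A' then (1:ℤ) else 0)) * ((if γ ∈ B then (1:ℤ) else 0) - (if γ ∈ B' then (1:ℤ) else 0))
        + (if ((γ ∈ UA ∧ γ ∉ A' ∧ γ ∉ B ∧ γ ∈ UB') ∨ (γ ∈ UA' ∧ γ ∉ A ∧ γ ∈ UB ∧ γ ∉ B')) then (1:ℤ) else 0)) < 0 then (1:ℤ) else 0) with hdt
  have hqt_dt : ∀ γ, - dt γ ≤ qt γ := by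
    intro γ
    have key := topN (decide (γ ∈ A)) (decide (γ ∈ A')) (decide (γ ∈ B)) (decide (γ ∈ B')) (decide (γ ∈ UA)) (decide (γ ∈ UA')) (decide (γ ∈ UB)) (decide (γ ∈ UB')) (decide (γ ∈ LA)) (decide (γ ∈ LA')) (decide (γ ∈ LB)) (decide (γ ∈ LB'))
    simpa only [hqt, hdt, decide_eq_true_eq, Bool.decide_and, Bool.decide_or, decide_not] using key
  have hdt0 : ∀ γ, 0 ≤ dt γ := by
    intro γ; simp only [hdt]; split_ifs <;> norm_num
  rcases Finset.eq_empty_or_nonempty ZT with hZTe | hZTn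
  · -- no top in the down-set: bottoms are nonnegative
    rw [hZTe, Finset.sum_empty]
    have hb : 0 ≤ ∑ γ ∈ ZB, qb γ := Finset.sum_nonneg (fun γ _ => hqb0 γ)
    linarith
  · have hZBu : ZB = univ := hZ hZTn
    -- THEOREM Q (gen 29): Σ_γ (q_bot γ − [q_top γ < 0]) ≥ 0
    have hQ := AntitheticPureBroom.broom_lpure bar hbar A0 A0' B0 B0' A A' B B' UA UA' UB UB' hA hA' hB hB' hUA hUA' hUB hUB'
    have hQ' : 0 ≤ ∑ γ : α, (qb γ - dt γ) := by simpa only [hqb, hdt] using hQ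
    have hT : -(∑ γ : α, dt γ) ≤ ∑ γ ∈ ZT, qt γ := by
      rw [sumsub ZT qt, ← Finset.sum_neg_distrib]
      refine Finset.sum_le_sum (fun γ _ => ?_)
      by_cases hγ : γ ∈ ZT
      · simp only [hγ, if_true]; exact hqt_dt γ
      · simp only [hγ, if_false]; linarith [hdt0 γ]
    rw [hZBu]
    have : ∑ γ : α, (qb γ - dt γ) = (∑ γ : α, qb γ) - ∑ γ : α, dt γ := Finset.sum_sub_distrib (f := qb) (g := dt) (s := (univ : Finset α))
    linarith
end AntitheticRelBroom

end Summit.CriticalPhenomena.PercolationContinuityZ3.Theorems
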